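import Summits.BirchSwinnertonDyer.BirchSwinnertonDyer.Theorems.GoldfeldAllTwistsTwoConverseTwinNonSharpSelmerDualEightOne
import Summits.BirchSwinnertonDyer.BirchSwinnertonDyer.Theorems.GoldfeldAllTwistsTwoConverseTwinAdditiveTwoPrimesTwistSelmerPlusPOneAlpha
import Summits.BirchSwinnertonDyer.BirchSwinnertonDyer.Theorems.GoldfeldAllTwistsTwoConverseTwinAdditiveInertTwistDescent
import Summits.BirchSwinnertonDyer.BirchSwinnertonDyer.Theorems.GoldfeldAllTwistsTwoConverseTwinNonSharpRankThree
import HarnessLib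

set_option linter.dupNamespace false -- namespace `…BirchSwinnertonDyer.BirchSwinnertonDyer…` is the cell's (D-0017 nested layout)
set_option autoImplicit false

/-!
# First descent on the stratum `q ≡ 7 (8)`, `p ≡ 1 (8)` of `W ≅ 49a1^{(−2qp)}` WITHOUT type or `(p/q)` condition, II: `S = S(−42qp, 448q²p²) ⊆ {1, 7, p, 7p}`,
# hence `rank W(ℚ) ≤ 3` for EVERY `W` on the stratum — in particular on the `(4,8)` cell b71+, where `3` is ATTAINED (OBJECT 9): `rank = 3` at `(311, 193)`

Cell `bsd-goldfeld`, seat `bsd-goldfeld-s1p-c3x` (gen 21); planner RULING (cdxxxviii), OPTIONAL OBJECT 10 «FIRST-DESCENT UPPER BOUNDS ON THE (4,8)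
CELLS», TRANCHE A (b71+), file 2 of 2. `--supports stmt-BirchSwinnertonDyer-20044` as a HELPER (rank axis). FACT-FREE: no print binder, no
definition, no `sorry`; Theses-free.

§1 **`S(−42qp, 448q²p²) ⊆ {1, 7, p, 7p}`** for `q ≡ 7 (8)`, `(q/7) = −1`, `p ≡ 1 (8)` (no `(−7/p)`, no type, no `(p/q)`): the C7 proof
(`twoIsogenySelmerGroup_twoPrimesTwist_subset_pOne`, `…SelmerPOne` §3) with its four `q`-adic kills of `p, 2p, 7p, 14p` (which used `(p/q) = −1`)
replaced by the symbol-free `2`-adic kills of `2p, 14p` (`not_isSoluble_two_class_twoP_plusPOne`, `…fourteenP_plusPOne`, a71+'s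
`…SelmerPlusPOneAlpha`) and of `2, 14` (`not_isSoluble_two_class_two_even`, `…fourteen_even` at `u = −qp ≡ 1 (8)`, `…TwinAdditiveTwoAdicPOne`);
negatives die over `ℝ`, the eight `q`-classes at `q` (`(−7/q) = −1`); `1, 7, p, 7p` survive (`#S ≤ 4`; sharp on b71+: kit j332193, `S = {1, 7, p, 7p}` on
43/43 rows).
§2 **The count**: `#S ≤ 4`, `#S′ ≤ 8` (file 1) and the tree's `rank + 2 ≤ dim₂ S + dim₂ S′` (`twoIsogeny_mordellWeilRank_add_two_le_holds`,
Silverman–Tate §3.6) give **`rank E(ℚ) ≤ 3`** for the two-torsion model `E = [0, −42qp, 0, 448q²p², 0]`, transported to **every model `W`**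
(`C • W = cm7^{(−2qp)}`: `smul_eq_twoTorsionModel_of_smul_eq_quadraticTwist` + `mordellWeilRank_variableChange_holds`, the chain of
`rank_le_one_and_sha_two_twoPrimesTwist`).
§3 **Cell b71+** (binders = the capstone R p725669's LETTER FOR LETTER minus `hcell`, plus the b71+ clause exactly as in OBJECT 9's
`not_forall_mordellWeilRank_eq_one_cellB71plus`): `rank W(ℚ) ≤ 3` for every `W` — to be read next to «`rank W(ℚ) = 1` for every `W` is FALSE» and
«`3 ≤ rank W(ℚ)` at `(311,193)`» (`three_le_mordellWeilRank_twoPrimesTwist_311_193`); and **`rank W(ℚ) = 3` EXACTLY for every `W ≅ 49a1^{(−120046)}`**.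
So on b71+ the first descent is the whole story for cell-uniform rank bounds: `≤ 3` everywhere, `= 3` attained.
HONEST FRAMING: the textbook first-descent bound made kernel for this family, completing the sixteen-cell map in the tree («12 cells: rank ≤ 1
unconditionally, = 1 ∧ r_an = 1 ∧ Ш finite modulo named print; b71+ (and, in later tranches, b31+, C1, C2): rank ≤ 3 unconditionally, = 3
attained»); first descent only; NO width change (b71+ stays director width — second descent / `rk₄ ≥ 1`; not a road to rank one); items 19349 /
19350 / 20044 / 19140 neither closed nor advanced; twist-density of the two-primes family ZERO; BSD is not proved by any of this.

References: [SilvermanAEC2009] Prop. X.4.9, Example X.4.10, III.3.1(b); [SilvermanTate2015] §3.6; [Serre1973] Ch. II §3.3 Thm 4.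
-/

noncomputable section

open scoped Classical

open WeierstrassCurve Literature.NumberTheory.EllipticCurves

namespace Summit.BirchSwinnertonDyer.BirchSwinnertonDyer.Theorems.GoldfeldGoodTwists

/-! ## §1 `S(−42qp, 448q²p²) ⊆ {1, 7, p, 7p}` on the stratum `q ≡ 7 (8)`, `(q/7) = −1`, `p ≡ 1 (8)` -/

section SelmerSEightOne
variable {q p : ℕ} [Fact q.Prime] [Fact p.Prime]

omit [Fact q.Prime] [Fact p.Prime] in
/-- `q ≡ 7 (8)`, `p ≡ 1 (8)` ⇒ `u = −qp ≡ 1 (mod 8)`. [folklore] -/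
private theorem eight_dvd_neg_mul_sub_one (hq8 : q % 8 = 7) (hp8 : p % 8 = 1) : (8 : ℤ) ∣ -((q : ℤ) * p) - 1 := by
  have hqp8 : q * p % 8 = 7 := by rw [Nat.mul_mod, hq8, hp8]
  obtain ⟨k, hk⟩ : ∃ k, q * p = 8 * k + 7 := ⟨q * p / 8, by omega⟩
  refine ⟨-(k : ℤ) - 1, ?_⟩
  rw [show ((q : ℤ) * p) = ((q * p : ℕ) : ℤ) by push_cast; ring, hk]
  push_cast
  ring

set_option maxHeartbeats 400000 in -- sixteen positive classes, each with its local computation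
/-- **`S(−42qp, 448q²p²) ⊆ {1, 7, p, 7p}`** for `q ≡ 7 (8)`, `(q/7) = −1`, `p ≡ 1 (8)` (the whole stratum: cells C7, C7A, a71+, b71+; sharp on b71+
by the kit): negatives at `ℝ`, the `q`-classes at `q`, `2, 14, 2p, 14p` at `2`. [cite: SilvermanAEC2009, Prop. X.4.9 and Example X.4.10]
[cite: Serre1973, Ch. II §3.3 Thm 4] -/
theorem twoIsogenySelmerGroup_twoPrimesTwist_subset_four_eightOne (hq8 : q % 8 = 7) (hq7 : jacobiSym q 7 = -1) (hp8 : p % 8 = 1) :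
    twoIsogenySelmerGroup (-42 * ((q : ℤ) * p)) (448 * ((q : ℤ) * p) ^ 2) ⊆ ({1, 7, (p : ℤ), (p : ℤ) * 7} : Finset ℤ) := by
  have hq : q.Prime := Fact.out
  have hp : p.Prime := Fact.out
  have hqZ : Prime (q : ℤ) := Nat.prime_iff_prime_int.mp hq
  have hpZ : Prime (p : ℤ) := Nat.prime_iff_prime_int.mp hp
  have hq0 : (q : ℤ) ≠ 0 := by exact_mod_cast hq.ne_zero
  have hp0 : (p : ℤ) ≠ 0 := by exact_mod_cast hp.ne_zero
  have hq4 : q % 4 = 3 := by omega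
  have hq2 : q ≠ 2 := by rintro rfl; norm_num at hq4
  have hp2 : p ≠ 2 := by rintro rfl; norm_num at hp8
  have hqp : q ≠ p := by rintro rfl; omega
  have hq7' : q ≠ 7 := by
    rintro rfl; rw [jacobiSym.mod_left] at hq7; norm_num at hq7
  obtain ⟨-, hm7q⟩ := legendreSym_seven_and_neg_seven_of_three_mod_four hq4 hq7
  have h8 := eight_dvd_neg_mul_sub_one hq8 hp8
  -- non-vanishing modulo `q`
  have hpq0 : (p : ZMod q) ≠ 0 := by
    rw [Ne, ZMod.natCast_eq_zero_iff]; exact fun h ↦ hqp ((Nat.prime_dvd_prime_iff_eq hq hp).mp h)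
  have h2q0 : ((2 : ℤ) : ZMod q) ≠ 0 := by
    rw [show ((2 : ℤ) : ZMod q) = ((2 : ℕ) : ZMod q) by push_cast; rfl, Ne, ZMod.natCast_eq_zero_iff]
    exact fun h ↦ hq2 ((Nat.prime_dvd_prime_iff_eq hq Nat.prime_two).mp h)
  have h2pq : ((2 * p : ℤ) : ZMod q) ≠ 0 := by push_cast; exact mul_ne_zero (by exact_mod_cast h2q0) hpq0
  have hns_disc_q : ¬ IsSquare ((((-42 * p) ^ 2 - 4 * (448 * p ^ 2) : ℤ)) : ZMod q) := by
    rw [show ((-42 * p) ^ 2 - 4 * (448 * p ^ 2) : ℤ) = -7 * (2 * p) ^ 2 by ring]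
    exact not_isSquare_mul_sq_zmod h2pq ((legendreSym.eq_neg_one_iff q).mp hm7q)
  have hb : (448 * ((q : ℤ) * p) ^ 2 : ℤ) ≠ 0 := by positivity
  intro d hd
  rw [mem_twoIsogenySelmerGroup_iff hb] at hd
  obtain ⟨hsqf, ⟨d', hdd'⟩, hloc⟩ := hd
  have hd'eq : (448 * ((q : ℤ) * p) ^ 2 : ℤ) / d = d' := by rw [hdd', Int.mul_ediv_cancel_left _ hsqf.ne_zero]
  rw [hd'eq] at hloc
  obtain ⟨hreal, hpadic⟩ := hloc
  simp only [Finset.mem_insert, Finset.mem_singleton]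
  -- negatives die at `ℝ`
  have hdpos : 0 < d := by
    rcases lt_or_gt_of_ne hsqf.ne_zero with hneg | hpos
    · exfalso
      have hbpos : (0 : ℤ) < 448 * ((q : ℤ) * p) ^ 2 := by positivity
      have hd'neg : d' < 0 := by
        by_contra hcon
        nlinarith [mul_nonpos_iff.mpr (Or.inr ⟨hneg.le, le_of_not_gt hcon⟩)]
      have ha : (-42 * ((q : ℤ) * p)) ≤ 0 := by
        have : (0 : ℤ) ≤ (q : ℤ) * p := by positivity
        linarith
      exact not_isSoluble_real_twoIsogenyQuartic_of_neg hneg hd'neg ha hreal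
    · exact hpos
  -- the `q`-classes die at `q` (`(−7/q) = −1`)
  have hqd : ¬ (q : ℤ) ∣ d := by
    rintro ⟨e, rfl⟩
    have h1 : e * d' = 448 * q * p ^ 2 := mul_left_cancel₀ hq0 (by linear_combination (-1 : ℤ) * hdd')
    have h3 : (q : ℤ) ∣ e * d' := ⟨448 * p ^ 2, by rw [h1]; ring⟩
    rcases hqZ.dvd_or_dvd h3 with h4 | h4
    · obtain ⟨e₁, rfl⟩ := h4
      exact hqZ.not_unit (hsqf (q : ℤ) ⟨e₁, by ring⟩)
    · obtain ⟨e', rfl⟩ := h4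
      have hm : e * e' = 448 * p ^ 2 := mul_left_cancel₀ hq0 (by linear_combination h1)
      exact not_isSoluble_padic_of_prime_dvd_coeffs (p := q) (c := -42 * p) (by ring) rfl rfl hm hns_disc_q (hpadic q)
  -- `d ∣ 14qp` prime to `q`: `d ∣ 14p`
  have h0 : d ∣ 448 * ((q : ℤ) * p) ^ 2 := ⟨d', hdd'⟩
  have h1 : d ∣ (14 * ((q : ℤ) * p)) ^ 6 := h0.trans ⟨16807 * ((q : ℤ) * p) ^ 4, by ring⟩
  have h14qp : d ∣ 14 * ((q : ℤ) * p) := (hsqf.dvd_pow_iff_dvd (by norm_num)).mp h1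
  have hcopq : IsCoprime d (q : ℤ) := ((hqZ.irreducible.coprime_iff_not_dvd).mpr hqd).symm
  have h14p : d ∣ 14 * (p : ℤ) := by
    have : d ∣ (q : ℤ) * (14 * p) := by rw [show (q : ℤ) * (14 * p) = 14 * (q * p) by ring]; exact h14qp
    exact hcopq.dvd_of_dvd_mul_left this
  by_cases hpd : (p : ℤ) ∣ d
  · -- `d = p·e`, `e ∣ 14`: `p`, `7p` survive, `2p`, `14p` die at `2`
    obtain ⟨e, rfl⟩ := hpd
    have he14 : e ∣ 14 := by
      have : (p : ℤ) * e ∣ (p : ℤ) * 14 := by rw [mul_comm (p : ℤ) 14]; exact h14p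
      exact (mul_dvd_mul_iff_left hp0).mp this
    have hepos : 0 < e := pos_of_mul_pos_right hdpos (by positivity)
    have hele : e ≤ 14 := Int.le_of_dvd (by norm_num) he14
    have hd'e : e * d' = 448 * q ^ 2 * p := mul_left_cancel₀ hp0 (by linear_combination (-1 : ℤ) * hdd')
    have hne2 : e ≠ 2 := by
      rintro rfl; exact not_isSoluble_two_class_twoP_plusPOne hq8 hp8 rfl (by ring)
        (mul_left_cancel₀ (by norm_num : (2 : ℤ) ≠ 0) (by linear_combination hd'e)) (hpadic 2)
    have hne14 : e ≠ 14 := by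
      rintro rfl; exact not_isSoluble_two_class_fourteenP_plusPOne hq8 hp8 rfl (by ring)
        (mul_left_cancel₀ (by norm_num : (14 : ℤ) ≠ 0) (by linear_combination hd'e)) (hpadic 2)
    obtain ⟨k, hk⟩ := he14
    interval_cases e <;> first | (exfalso; omega) | simp
  · -- `d ∣ 14`, `d > 0`: `1`, `7` survive, `2`, `14` die at `2`
    have hcopp : IsCoprime d (p : ℤ) := ((hpZ.irreducible.coprime_iff_not_dvd).mpr hpd).symm
    have hd14 : d ∣ 14 := hcopp.dvd_of_dvd_mul_right h14p
    have hle : d ≤ 14 := Int.le_of_dvd (by norm_num) hd14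
    have hn2 : d ≠ 2 := by
      rintro rfl
      exact not_isSoluble_two_class_two_even (u := -((q : ℤ) * p)) h8 (by ring) rfl
        (show d' = 224 * (-((q : ℤ) * p)) ^ 2 by linarith) (hpadic 2)
    have hn14 : d ≠ 14 := by
      rintro rfl
      exact not_isSoluble_two_class_fourteen_even (u := -((q : ℤ) * p)) h8 (by ring) rfl
        (show d' = 32 * (-((q : ℤ) * p)) ^ 2 by linarith) (hpadic 2)
    obtain ⟨k, hk⟩ := hd14
    interval_cases d <;> first | (exfalso; omega) | simp

/-- **`#S(−42qp, 448q²p²) ≤ 4`** on the stratum `q ≡ 7 (8)`, `(q/7) = −1`, `p ≡ 1 (8)` (sharp on b71+ by the kit). [cite: SilvermanAEC2009, Prop. X.4.9] -/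
theorem card_twoIsogenySelmerGroup_twoPrimesTwist_le_four_eightOne (hq8 : q % 8 = 7) (hq7 : jacobiSym q 7 = -1) (hp8 : p % 8 = 1) :
    (twoIsogenySelmerGroup (-42 * ((q : ℤ) * p)) (448 * ((q : ℤ) * p) ^ 2)).card ≤ 4 :=
  (Finset.card_le_card (twoIsogenySelmerGroup_twoPrimesTwist_subset_four_eightOne hq8 hq7 hp8)).trans Finset.card_le_four

/-! ## §2 The count: `rank ≤ 3` on the whole stratum -/

/-- **`rank E(ℚ) ≤ 3`** for the two-torsion model `E = [0, −42qp, 0, 448q²p², 0]` of `49a1^{(−2qp)}` on the stratum `q ≡ 7 (8)`, `(q/7) = −1`,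
`p ≡ 1 (8)`, `(−7/p) = +1`: `rank + 2 ≤ dim₂ S + dim₂ S′ ≤ 2 + 3` (the tree's `twoIsogeny_mordellWeilRank_add_two_le_holds`, Silverman–Tate §3.6,
with §1 and file 1). UNCONDITIONAL, fact-free. [cite: SilvermanTate2015, §3.6 (2^r = #α(Γ)·#ᾱ(Γ̄)/4)] [cite: SilvermanAEC2009, Prop. X.4.7] -/
theorem mordellWeilRank_le_three_twoTorsionModel_twoPrimesTwist_eightOne (hq8 : q % 8 = 7) (hq7 : jacobiSym q 7 = -1) (hp8 : p % 8 = 1)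
    (hp7 : legendreSym p (-7) = 1) :
    (⟨0, ((-42 * ((q : ℤ) * p) : ℤ) : ℚ), 0, ((448 * ((q : ℤ) * p) ^ 2 : ℤ) : ℚ), 0⟩ : WeierstrassCurve ℚ).mordellWeilRank ≤ 3 := by
  have hq : q.Prime := Fact.out
  have hp : p.Prime := Fact.out
  have hq0 : (q : ℤ) ≠ 0 := by exact_mod_cast hq.ne_zero
  have hp0 : (p : ℤ) ≠ 0 := by exact_mod_cast hp.ne_zero
  have hab : (448 * ((q : ℤ) * p) ^ 2) * ((-42 * ((q : ℤ) * p)) ^ 2 - 4 * (448 * ((q : ℤ) * p) ^ 2)) ≠ 0 := by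
    rw [show (-42 * ((q : ℤ) * p)) ^ 2 - 4 * (448 * ((q : ℤ) * p) ^ 2) = -28 * ((q : ℤ) * p) ^ 2 by ring]
    exact mul_ne_zero (by positivity) (mul_ne_zero (by norm_num) (pow_ne_zero 2 (mul_ne_zero hq0 hp0)))
  have h := twoIsogeny_mordellWeilRank_add_two_le_holds (-42 * ((q : ℤ) * p)) (448 * ((q : ℤ) * p) ^ 2) hab
  have hS := card_twoIsogenySelmerGroup_twoPrimesTwist_le_four_eightOne hq8 hq7 hp8
  have hS' := card_twoIsogenySelmerGroup'_twoPrimesTwist_le_eight_eightOne hq8 hq7 hp8 hp7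
  have e1 := two_pow_twoIsogenySelmerRank_eq_card hab
  have e2 := two_pow_twoIsogenySelmerRank'_eq_card hab
  have hsr : twoIsogenySelmerRank (-42 * ((q : ℤ) * p)) (448 * ((q : ℤ) * p) ^ 2) ≤ 2 := by
    by_contra hc
    have h3 : 2 ^ 3 ≤ 2 ^ twoIsogenySelmerRank (-42 * ((q : ℤ) * p)) (448 * ((q : ℤ) * p) ^ 2) := Nat.pow_le_pow_right (by norm_num) (by omega)
    omega
  have hsr' : twoIsogenySelmerRank' (-42 * ((q : ℤ) * p)) (448 * ((q : ℤ) * p) ^ 2) ≤ 3 := by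
    by_contra hc
    have h4 : 2 ^ 4 ≤ 2 ^ twoIsogenySelmerRank' (-42 * ((q : ℤ) * p)) (448 * ((q : ℤ) * p) ^ 2) := Nat.pow_le_pow_right (by norm_num) (by omega)
    omega
  omega

/-- **`rank W(ℚ) ≤ 3` for EVERY model `W` of `49a1^{(−2qp)}` on the stratum** `q ≡ 7 (8)`, `(q/7) = −1`, `p ≡ 1 (8)`, `(−7/p) = +1` (cells C7, C7A,
a71+, b71+; on the first three the landed sharp descents give `≤ 1`), in the capstone's spelling `C • W = cm7.quadraticTwist (−(2·q·p))`; transport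
by the lane's `smul_eq_twoTorsionModel_of_smul_eq_quadraticTwist` + `mordellWeilRank_variableChange_holds`. [cite: SilvermanAEC2009, III.3.1(b) and VIII.6]
[cite: SilvermanTate2015, §3.6] -/
theorem mordellWeilRank_le_three_twoPrimesTwist_eightOne (hq8 : q % 8 = 7) (hq7 : jacobiSym q 7 = -1) (hp8 : p % 8 = 1)
    (hp7 : legendreSym p (-7) = 1) (W : WeierstrassCurve ℚ) [W.IsElliptic] (C : VariableChange ℚ)
    (hC : C • W = cm7.quadraticTwist (-(2 * (q : ℚ) * p))) : W.mordellWeilRank ≤ 3 := by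
  have hC' : C • W = cm7.quadraticTwist (((-2 * ((q : ℤ) * p) : ℤ)) : ℚ) := by
    rw [hC]; congr 1; push_cast; ring
  have hE := (smul_eq_twoTorsionModel_of_smul_eq_quadraticTwist (-2 * ((q : ℤ) * p)) W C hC').trans
    (show (⟨0, ((21 * (-2 * ((q : ℤ) * p)) : ℤ) : ℚ), 0, ((112 * (-2 * ((q : ℤ) * p)) ^ 2 : ℤ) : ℚ), 0⟩ : WeierstrassCurve ℚ) =
        ⟨0, ((-42 * ((q : ℤ) * p) : ℤ) : ℚ), 0, ((448 * ((q : ℤ) * p) ^ 2 : ℤ) : ℚ), 0⟩ by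
      ext <;> push_cast <;> ring)
  have hrk := mordellWeilRank_variableChange_holds W
    ((⟨(Units.mk0 (2 : ℚ) two_ne_zero)⁻¹, 2 * (((-2 * ((q : ℤ) * p) : ℤ)) : ℚ), 0, 0⟩ : VariableChange ℚ) * C)
  unfold mordellWeilRank_variableChange at hrk
  rw [← hrk, hE]
  exact mordellWeilRank_le_three_twoTorsionModel_twoPrimesTwist_eightOne hq8 hq7 hp8 hp7

end SelmerSEightOne

/-! ## §3 Cell b71+: `rank ≤ 3` for all, `= 3` attained -/

section CellB71plus

/-- **Cell b71+: `rank W(ℚ) ≤ 3` for every `W ≅ 49a1^{(−2qp)}`** — binders = the capstone R p725669's (`analyticRank_eq_one_twoPrimesTwist_sharpLocus_of_print`)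
LETTER FOR LETTER minus `hcell`, plus the b71+ clause `(p/q) = +1 ∧ β ∧ p ≡ 1 (8) ∧ q ≡ 7 (8)` exactly as in OBJECT 9's
`not_forall_mordellWeilRank_eq_one_cellB71plus` (where «`rank W(ℚ) = 1` for every such `W`» is refuted) — from §2 (the clause's `(p/q)` and β
parts are not used: the bound holds on the whole stratum). [cite: SilvermanTate2015, §3.6] -/
theorem mordellWeilRank_le_three_twoPrimesTwist_cellB71plus {q p : ℕ} (hq : q.Prime) (_h3 : 3 < q) (_hq4 : q % 4 = 3) (hq7 : jacobiSym q 7 = -1)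
    [Fact p.Prime] (_hp4 : p % 4 = 1) (hp7 : legendreSym p (-7) = 1)
    (hcell : jacobiSym (p : ℤ) q = 1 ∧ (∃ x : ZMod p, x ^ 4 = -7) ∧ p % 8 = 1 ∧ q % 8 = 7)
    (W : WeierstrassCurve ℚ) [W.IsElliptic] (C : VariableChange ℚ) (hC : C • W = cm7.quadraticTwist (-(2 * (q : ℚ) * p))) :
    W.mordellWeilRank ≤ 3 := by
  haveI : Fact q.Prime := ⟨hq⟩
  exact mordellWeilRank_le_three_twoPrimesTwist_eightOne hcell.2.2.2 hq7 hcell.2.2.1 hp7 W C hC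

/-- **`rank W(ℚ) = 3` EXACTLY for every model `W` of `49a1^{(−2·311·193)} = 49a1^{(−120046)}`** (cell b71+): `≤ 3` by §2 at `(q,p) = (311,193)`
(cell arithmetic `cellB71_311_193` of OBJECT 9) and `3 ≤` by OBJECT 9's kernel certificate `three_le_mordellWeilRank_twoPrimesTwist_311_193`
(explicit points, kit j333313). So the first-descent bound `rank ≤ 3` on b71+ is ATTAINED. UNCONDITIONAL, fact-free. [cite: SilvermanTate2015, §3.6] -/
theorem mordellWeilRank_eq_three_twoPrimesTwist_311_193 (W : WeierstrassCurve ℚ) [W.IsElliptic] (C : VariableChange ℚ)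
    (hC : C • W = cm7.quadraticTwist (-(2 * ((311 : ℕ) : ℚ) * ((193 : ℕ) : ℚ)))) : W.mordellWeilRank = 3 := by
  obtain ⟨hq, hp, hq8, hq7, hp8, hp7, -, -⟩ := cellB71_311_193
  haveI : Fact (Nat.Prime 311) := ⟨hq⟩
  haveI : Fact (Nat.Prime 193) := ⟨hp⟩
  refine le_antisymm ?_ (three_le_mordellWeilRank_twoPrimesTwist_311_193 W C hC)
  exact mordellWeilRank_le_three_twoPrimesTwist_eightOne (q := 311) (p := 193) hq8 hq7 hp8
    (by rw [legendreSym_neg_seven_eq_jacobiSym (by norm_num)]; exact hp7) W C hC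

/-- **b71+ summary: `rank ≤ 3` for every `W` on the cell, and `∃` a member (`(q,p) = (311,193)`) with `rank = 3`** — the first descent is sharp for
cell-uniform rank bounds on b71+. [cite: SilvermanTate2015, §3.6] -/
theorem mordellWeilRank_le_three_and_attained_cellB71plus :
    (∀ {q p : ℕ} (_ : q.Prime) (_ : 3 < q) (_ : q % 4 = 3) (_ : jacobiSym q 7 = -1) [Fact p.Prime] (_ : p % 4 = 1)
        (_ : legendreSym p (-7) = 1) (_ : jacobiSym (p : ℤ) q = 1 ∧ (∃ x : ZMod p, x ^ 4 = -7) ∧ p % 8 = 1 ∧ q % 8 = 7)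
        (W : WeierstrassCurve ℚ) [W.IsElliptic] (C : VariableChange ℚ),
        C • W = cm7.quadraticTwist (-(2 * (q : ℚ) * p)) → W.mordellWeilRank ≤ 3) ∧
    (∃ (q p : ℕ) (_ : q.Prime) (_ : 3 < q) (_ : q % 4 = 3) (_ : jacobiSym q 7 = -1) (_ : Fact p.Prime) (_ : p % 4 = 1)
        (_ : legendreSym p (-7) = 1) (_ : jacobiSym (p : ℤ) q = 1 ∧ (∃ x : ZMod p, x ^ 4 = -7) ∧ p % 8 = 1 ∧ q % 8 = 7)
        (W : WeierstrassCurve ℚ) (_ : W.IsElliptic) (C : VariableChange ℚ),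
        C • W = cm7.quadraticTwist (-(2 * (q : ℚ) * p)) ∧ W.mordellWeilRank = 3) := by
  refine ⟨fun hq h3 hq4 hq7 _ hp4 hp7 hcell W _ C hC ↦
    mordellWeilRank_le_three_twoPrimesTwist_cellB71plus hq h3 hq4 hq7 hp4 hp7 hcell W C hC, ?_⟩
  obtain ⟨hq, hp, hq8, hq7, hp8, hp7, hpq, htyp⟩ := cellB71_311_193
  haveI : Fact (Nat.Prime 193) := ⟨hp⟩
  haveI := isElliptic_quadraticTwist (W := cm7) (d := -(2 * ((311 : ℕ) : ℚ) * ((193 : ℕ) : ℚ))) (by norm_num)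
  exact ⟨311, 193, hq, by norm_num, by norm_num, hq7, inferInstance, by norm_num,
    by rw [legendreSym_neg_seven_eq_jacobiSym (by norm_num)]; exact hp7, ⟨by exact_mod_cast hpq, htyp, hp8, hq8⟩,
    cm7.quadraticTwist (-(2 * ((311 : ℕ) : ℚ) * ((193 : ℕ) : ℚ))), inferInstance, 1, one_smul _ _,
    mordellWeilRank_eq_three_twoPrimesTwist_311_193 _ 1 (one_smul _ _)⟩

end CellB71plus

end Summit.BirchSwinnertonDyer.BirchSwinnertonDyer.Theorems.GoldfeldGoodTwists

end
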